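import Summits.ValiantsHypothesis.ValiantsHypothesis.Theorems.NewtonUnitEquationsTwoProductsRaySplitLift
import HarnessLib

/-!
# R11 (`freiman-ray-split`; Stage 1) — part B: the COEFFICIENT-SPAN LEMMA `[Z_{−i}^c] P̃ ∈ 𝒜_i`
The lifted tail `Ũ_j = phiT M (lin (cU j))` splits as `Uray j i + Urest j i` (pure `Z_i`-powers + `Z_i`-free part); hence
`P̃ = ∏_j (Uray j i + W j i)` with `W j i := 1 + Urest j i` `Z_i`-free, and for every exponent `c` with `c i = 0`:
`coeff (c + n·δ_i) P̃ = Σ_{U ⊆ [m]} coeff c (∏_{j∉U} W j i) · coeff (n·δ_i) (∏_{j∈U} Uray j i)` — the slice of `P̃` (and of `GT = P̃ − Q̃`) along the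
`Z_i`-line through `c` lies in the span of the `2^m` (`2^{m+1}`) FIXED pure-`Z_i` polynomials `∏_{j∈U} Uray j i` (the card's «only non-formal step»).
Second hand val-lit-p3 g16; first hand val-port-3 g2.  Proper positive sub-case rung; nothing here closes 5906; VP ≠ VNP is NOT proved.
-/

noncomputable section
set_option linter.dupNamespace false
set_option linter.unusedSectionVars false

namespace Summit.ValiantsHypothesis.ValiantsHypothesis.Theorems.NewtonUnitEquations.TwoProducts.PermutationType
namespace R11
open scoped BigOperators
open MvPolynomial
open Summit.ValiantsHypothesis.ValiantsHypothesis.Theorems.NewtonUnitEquations.TwoProducts.FormalLogLinearisation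
open Summit.ValiantsHypothesis.ValiantsHypothesis.Theorems.NewtonUnitEquations.TwoProducts.PlanarCell
open Summit.ValiantsHypothesis.ValiantsHypothesis.Theorems.NewtonUnitEquations.TwoProducts.RaySplit

section Axes
variable {K : ℕ} (i : Fin K)

/-- `Z_i`-PURE: every monomial is a power of `Z_i`. [folklore] -/
def Pure (P : MvPolynomial (Fin K) ℂ) : Prop := ∀ q ∈ P.support, ∀ i', i' ≠ i → q i' = 0

/-- `Z_i`-FREE: no monomial involves `Z_i`. [folklore] -/
def Free (P : MvPolynomial (Fin K) ℂ) : Prop := ∀ q ∈ P.support, q i = 0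

/-- **Axes coefficient lemma**: for `A` pure and `W` free, `coeff (c + n·δ_i) (A * W) = coeff (n·δ_i) A * coeff c W` when `c i = 0`. [folklore] -/
theorem coeff_mul_pure_free (A W : MvPolynomial (Fin K) ℂ) (hA : Pure i A) (hW : Free i W) (c : Fin K →₀ ℕ) (hc : c i = 0) (n : ℕ) :
    coeff (c + Finsupp.single i n) (A * W) = coeff (Finsupp.single i n) A * coeff c W := by
  classical
  rw [coeff_mul]
  rw [Finset.sum_eq_single (Finsupp.single i n, c)]
  · intro pq hpq hne
    rw [Finset.HasAntidiagonal.mem_antidiagonal] at hpq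
    -- a contributing pair must be (pure part, free part)
    by_cases hp : pq.1 ∈ A.support
    · by_cases hq : pq.2 ∈ W.support
      · exfalso; apply hne
        have h1 : pq.1 = Finsupp.single i n := by
          ext i'
          by_cases hi : i' = i
          · subst hi
            have := congrArg (fun f : Fin K →₀ ℕ => f i') hpq
            simp only [Finsupp.add_apply, Finsupp.single_eq_same, hc] at this
            rw [hW _ hq, add_zero, zero_add] at this
            simp [this]
          · rw [hA _ hp i' hi, Finsupp.single_apply, if_neg (fun h => hi h.symm)]
        have h2 : pq.2 = c := by
          have e1 : pq.1 + pq.2 = pq.1 + c := by rw [hpq, h1, add_comm]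
          exact add_left_cancel e1
        exact Prod.ext h1 h2
      · rw [notMem_support_iff.mp hq, mul_zero]
    · rw [notMem_support_iff.mp hp, zero_mul]
  · intro h
    exfalso; apply h
    rw [Finset.HasAntidiagonal.mem_antidiagonal, add_comm]

/-- Products of free polynomials are free. [folklore] -/
theorem free_prod {α : Type*} (s : Finset α) (f : α → MvPolynomial (Fin K) ℂ) (hf : ∀ a ∈ s, Free i (f a)) : Free i (∏ a ∈ s, f a) := by
  classical
  induction s using Finset.induction_on with
  | empty =>
    intro q hq
    rw [Finset.prod_empty, support_one, Finset.mem_singleton] at hq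
    simp [hq]
  | insert a s has ih =>
    intro q hq
    rw [Finset.prod_insert has] at hq
    obtain ⟨p, hp, r, hr, rfl⟩ : ∃ p ∈ (f a).support, ∃ r ∈ (∏ x ∈ s, f x).support, q = p + r := by
      have := support_mul _ _ hq
      rw [Finset.mem_add] at this
      obtain ⟨p, hp, r, hr, h⟩ := this
      exact ⟨p, hp, r, hr, h.symm⟩
    rw [Finsupp.add_apply, hf a (Finset.mem_insert_self a s) p hp,
      ih (fun b hb => hf b (Finset.mem_insert_of_mem hb)) r hr]

/-- Products of pure polynomials are pure. [folklore] -/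
theorem pure_prod {α : Type*} (s : Finset α) (f : α → MvPolynomial (Fin K) ℂ) (hf : ∀ a ∈ s, Pure i (f a)) : Pure i (∏ a ∈ s, f a) := by
  classical
  induction s using Finset.induction_on with
  | empty =>
    intro q hq i' _
    rw [Finset.prod_empty, support_one, Finset.mem_singleton] at hq
    simp [hq]
  | insert a s has ih =>
    intro q hq i' hi'
    rw [Finset.prod_insert has] at hq
    have := support_mul _ _ hq
    rw [Finset.mem_add] at this
    obtain ⟨p, hp, r, hr, rfl⟩ := this
    rw [Finsupp.add_apply, hf a (Finset.mem_insert_self a s) p hp i' hi',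
      ih (fun b hb => hf b (Finset.mem_insert_of_mem hb)) r hr i' hi']

/-- `1 + free` is free. [folklore] -/
theorem free_one_add (P : MvPolynomial (Fin K) ℂ) (hP : Free i P) : Free i (1 + P) := by
  classical
  intro q hq
  rcases Finset.mem_union.mp (support_add hq) with h | h
  · rw [support_one, Finset.mem_singleton] at h; simp [h]
  · exact hP q h

end Axes

section Span
variable {m K : ℕ}
variable (u v : Fin m → MvPolynomial (Fin 2) ℂ) (ι : Expo → Fin K) (ν : Expo → ℕ)

/-- The part of the lifted tail of chain `j` (coefficients `c`) on ray `i`: `Σ_{k : ι e_k = i} c_k · Z_i^{ν e_k}`. [val-idea-32] -/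
def Uray (c : Fin (sE u v) → ℂ) (i : Fin K) : MvPolynomial (Fin K) ℂ :=
  ∑ k, if ι (enum u v k) = i then c k • monomial (M u v ι ν k) 1 else 0

/-- The rest of the lifted tail (rays `≠ i`). [val-idea-32] -/
def Urest (c : Fin (sE u v) → ℂ) (i : Fin K) : MvPolynomial (Fin K) ℂ :=
  ∑ k, if ι (enum u v k) = i then 0 else c k • monomial (M u v ι ν k) 1

/-- The lifted tail splits along ray `i`. [folklore] -/
theorem phiT_lin_eq (c : Fin (sE u v) → ℂ) (i : Fin K) :
    phiT (M u v ι ν) (lin c) = Uray u v ι ν c i + Urest u v ι ν c i := by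
  classical
  unfold lin Uray Urest
  rw [map_sum, ← Finset.sum_add_distrib]
  refine Finset.sum_congr rfl fun k _ => ?_
  rw [map_smul, phiT_X]
  split_ifs <;> simp

/-- Support of `Uray`: lifted letters of ray `i`. [folklore] -/
theorem mem_support_Uray {c : Fin (sE u v) → ℂ} {i : Fin K} {q : Fin K →₀ ℕ} (hq : q ∈ (Uray u v ι ν c i).support) :
    ∃ k, ι (enum u v k) = i ∧ q = M u v ι ν k := by
  classical
  unfold Uray at hq
  obtain ⟨k, -, hk⟩ := Finset.mem_biUnion.mp (support_sum hq)
  by_cases h : ι (enum u v k) = i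
  · rw [if_pos h] at hk
    have := support_monomial_subset (support_smul hk)
    rw [Finset.mem_singleton] at this
    exact ⟨k, h, this⟩
  · rw [if_neg h] at hk; simp at hk

/-- Support of `Urest`: lifted letters of the other rays. [folklore] -/
theorem mem_support_Urest {c : Fin (sE u v) → ℂ} {i : Fin K} {q : Fin K →₀ ℕ} (hq : q ∈ (Urest u v ι ν c i).support) :
    ∃ k, ι (enum u v k) ≠ i ∧ q = M u v ι ν k := by
  classical
  unfold Urest at hq
  obtain ⟨k, -, hk⟩ := Finset.mem_biUnion.mp (support_sum hq)
  by_cases h : ι (enum u v k) = i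
  · rw [if_pos h] at hk; simp at hk
  · rw [if_neg h] at hk
    have := support_monomial_subset (support_smul hk)
    rw [Finset.mem_singleton] at this
    exact ⟨k, h, this⟩

/-- `Uray` is `Z_i`-pure. [folklore] -/
theorem pure_Uray (c : Fin (sE u v) → ℂ) (i : Fin K) : Pure i (Uray u v ι ν c i) := by
  intro q hq i' hi'
  obtain ⟨k, hk, rfl⟩ := mem_support_Uray u v ι ν hq
  unfold M; rw [hk, Finsupp.single_apply, if_neg (fun h => hi' h.symm)]

/-- `Urest` is `Z_i`-free. [folklore] -/
theorem free_Urest (c : Fin (sE u v) → ℂ) (i : Fin K) : Free i (Urest u v ι ν c i) := by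
  intro q hq
  obtain ⟨k, hk, rfl⟩ := mem_support_Urest u v ι ν hq
  unfold M; rw [Finsupp.single_apply, if_neg hk]

/-- The `Z_i`-free cofactor `W j i = 1 + Urest j i`. [folklore] -/
def W (c : Fin (sE u v) → ℂ) (i : Fin K) : MvPolynomial (Fin K) ℂ := 1 + Urest u v ι ν c i

/-- `W` is `Z_i`-free. [folklore] -/
theorem free_W (c : Fin (sE u v) → ℂ) (i : Fin K) : Free i (W u v ι ν c i) := free_one_add i _ (free_Urest u v ι ν c i)

/-- The lifted product expands over subsets: `∏_j (1 + Ũ_j) = Σ_U (∏_{j∈U} Uray j) · (∏_{j∉U} W j)`. [folklore] -/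
theorem phiT_prod_eq (c : Fin m → Fin (sE u v) → ℂ) (i : Fin K) :
    phiT (M u v ι ν) (∏ j, (1 + lin (c j))) =
      ∑ U ∈ (Finset.univ : Finset (Fin m)).powerset,
        (∏ j ∈ U, Uray u v ι ν (c j) i) * ∏ j ∈ Finset.univ \ U, W u v ι ν (c j) i := by
  classical
  rw [map_prod]
  have h : ∀ j, phiT (M u v ι ν) (1 + lin (c j)) = Uray u v ι ν (c j) i + W u v ι ν (c j) i := fun j => by
    rw [map_add, map_one, phiT_lin_eq]; unfold W; ring
  simp only [h]
  rw [Finset.prod_add]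

/-- **THE COEFFICIENT-SPAN LEMMA** (`[Z_{−i}^c] P̃ ∈ 𝒜_i`): for `c` with `c i = 0`, the coefficient of `c + n·δ_i` in the lifted product is a
FIXED (`n`-independent) combination of the coefficients of `n·δ_i` in the `2^m` pure polynomials `∏_{j∈U} Uray j i`. [val-idea-32, Stage 1 step (3)] -/
theorem coeff_phiT_prod_slice (c : Fin m → Fin (sE u v) → ℂ) (i : Fin K) (e : Fin K →₀ ℕ) (he : e i = 0) (n : ℕ) :
    coeff (e + Finsupp.single i n) (phiT (M u v ι ν) (∏ j, (1 + lin (c j)))) =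
      ∑ U ∈ (Finset.univ : Finset (Fin m)).powerset,
        coeff e (∏ j ∈ Finset.univ \ U, W u v ι ν (c j) i) * coeff (Finsupp.single i n) (∏ j ∈ U, Uray u v ι ν (c j) i) := by
  classical
  rw [phiT_prod_eq, coeff_sum]
  refine Finset.sum_congr rfl fun U _ => ?_
  rw [coeff_mul_pure_free i _ _ (pure_prod i U (fun j => Uray u v ι ν (c j) i) fun j _ => pure_Uray u v ι ν (c j) i)
    (free_prod i (Finset.univ \ U) (fun j => W u v ι ν (c j) i) fun j _ => free_W u v ι ν (c j) i) e he n, mul_comm]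

/-- The same for the lifted DIFFERENCE `GT = P̃ − Q̃`: its `Z_i`-slice through `e` is a fixed combination of the `2^{m+1}` pure polynomials
`∏_{j∈U} Uray_u j i`, `∏_{j∈U} Uray_v j i`. [val-idea-32, Stage 1] -/
theorem coeff_GT_slice (i : Fin K) (e : Fin K →₀ ℕ) (he : e i = 0) (n : ℕ) :
    coeff (e + Finsupp.single i n) (GT u v ι ν) =
      (∑ U ∈ (Finset.univ : Finset (Fin m)).powerset,
        coeff e (∏ j ∈ Finset.univ \ U, W u v ι ν (cU u v j) i) * coeff (Finsupp.single i n) (∏ j ∈ U, Uray u v ι ν (cU u v j) i)) -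
      ∑ U ∈ (Finset.univ : Finset (Fin m)).powerset,
        coeff e (∏ j ∈ Finset.univ \ U, W u v ι ν (cV u v j) i) * coeff (Finsupp.single i n) (∏ j ∈ U, Uray u v ι ν (cV u v j) i) := by
  unfold GT liftG
  rw [map_sub, coeff_sub, coeff_phiT_prod_slice u v ι ν (cU u v) i e he n, coeff_phiT_prod_slice u v ι ν (cV u v) i e he n]

end Span

end R11
end Summit.ValiantsHypothesis.ValiantsHypothesis.Theorems.NewtonUnitEquations.TwoProducts.PermutationType

end
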